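import Summits.CriticalPhenomena.PercolationContinuityZ3.Theorems.PercNearOneGluingAdditiveGluingObsLemma4Mult
import Mathlib.Algebra.BigOperators.Group.Finset.Powerset
import HarnessLib

/-!
# Crux `PercNearOneGluing.AdditiveGluing` (stmt-CriticalPhenomena-4576), line `tieline`: the base case of ML5

Support file (`--supports stmt-CriticalPhenomena-4576`, lead c9, skeleton v18): the registered stub `stub_ml5Base_c9` (the symbols
are explained in its docstring); the base case assumes that every pair `s(c, z)` with `z ∉ {a₁, a₂, c}` has weight `0`.  No definitions, no
named facts, no sorries.

Proof.  Split along the stars `σ_B` of the spectator `c` ("the open pairs at `c` are exactly those to `B`"), `B ⊆ {a₁, a₂}`: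
off a null set they partition (Kozma–Nitzan, proof of Thm. 4, `KNPreFKG.real_eq_sum_inter_starEvent`) and they are
independent of the pairs off `c` (`KNPreFKG.real_starEvent_inter_preimage`), whose law is the percolation measure `μ'` of
`G ∖ {c}`.  `N = {c ↮ a₁, c ↮ a₂}` is a.s. `σ_∅`; under a star with at most one relay an open path between non-spectator
vertices re-routes off `c` (Lemma 5's path surgery `KNPreFKG.walk_decomp`); under `σ_{a₁,a₂}` the relays are glued through `c`
(no gain).  Hence `μ(gain_o) ≤ T·μ'(gain_o)` and `G_max ≥ T·μ'(a₁ ↮ b, a₂ ↔ b)` (`T = μ σ_∅ + μ σ_{a₁} + μ σ_{a₂}`, `a₁` the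
weaker relay of `G ∖ {c}`), `μ(N) ≤ μ(σ_∅)`, `μ(N ∩ O_A) ≥ μ(σ_∅)·μ'(O_A)`, and the multiplicative observer Lemma 4 with Harris
on `G ∖ {c}` (`ObsLemma4Mult.obsLemma4Mult`: `μ'(gain_o) ≤ μ'(O_A)·μ'(a₁ ↮ b, a₂ ↔ b)`) closes the main case.  Coincidences:
`c ∈ {a₁, a₂}` (`N = ∅`), `a₁ = a₂` (`gain_o = ∅`), `o = c` (equality), `b = c` (Harris on `G ∖ {c}`).
[cite: KozmaNitzan2024, Lemma 4 (p. 9), Lemma 5 and Thm. 4 (pp. 13–14)] [cite: VandenbergHaggstromKahn2005, Thm. 1.4 (p. 7)]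
-/

namespace Summit.CriticalPhenomena.PercolationContinuityZ3.Theorems

open MeasureTheory Set Literature.Probability.LatticeModels Literature.Probability.Percolation
open Literature.Probability.Percolation.KNPreFKG

noncomputable section
open Classical

namespace ML5Base

/-- `N ≤ s₀`, `G ≤ T g`, `g ≤ O p`, `T p ≤ Δ`, `s₀ O ≤ N'` (nonnegative factors), `m ≤ B` give `N G ≤ N' (Δ + B − m) + R`
for `R ≥ 0` (here `Δ + B = U`). [folklore] -/
theorem arith_chain {N G s0 T g O p NO U B m R : ℝ} (hN : N ≤ s0) (hG : G ≤ T * g) (hH : g ≤ O * p)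
    (hD : T * p ≤ U - B) (hNO : s0 * O ≤ NO) (hm : m ≤ B) (hG0 : 0 ≤ G) (hs0 : 0 ≤ s0) (hT : 0 ≤ T) (hp : 0 ≤ p)
    (hNO0 : 0 ≤ NO) (hR : 0 ≤ R) : N * G ≤ NO * (U - m) + R :=
  calc N * G ≤ s0 * (T * (O * p)) := (mul_le_mul_of_nonneg_right hN hG0).trans
        (mul_le_mul_of_nonneg_left (hG.trans (mul_le_mul_of_nonneg_left hH hT)) hs0)
    _ = (s0 * O) * (T * p) := by ring
    _ ≤ NO * (U - m) := mul_le_mul hNO (hD.trans (sub_le_sub_left hm U)) (mul_nonneg hT hp) hNO0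
    _ ≤ NO * (U - m) + R := le_add_of_nonneg_right hR

/-- `N ≤ s₀`, `G ≤ s₁ X + s₂ Y`, `X + Y ≤ O D`, `sⱼ D ≤ M`, `s₀ O ≤ N'` (nonnegative quantities) give
`N G ≤ N' M + R` for `R ≥ 0`. [folklore] -/
theorem arith_center {N G s0 s1 s2 X Y O D M NO R : ℝ} (hN : N ≤ s0) (hG : G ≤ s1 * X + s2 * Y)
    (hXY : X + Y ≤ O * D) (h1 : s1 * D ≤ M) (h2 : s2 * D ≤ M) (hNO : s0 * O ≤ NO) (hG0 : 0 ≤ G) (hs0 : 0 ≤ s0)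
    (hs1 : 0 ≤ s1) (hs2 : 0 ≤ s2) (hX : 0 ≤ X) (hY : 0 ≤ Y) (hO : 0 ≤ O) (hD : 0 ≤ D) (hR : 0 ≤ R) : N * G ≤ NO * M + R := by
  have hM : 0 ≤ M := (mul_nonneg hs1 hD).trans h1
  have hkey : s1 * X + s2 * Y ≤ M * O := by
    rcases le_total s1 s2 with h | h
    · nlinarith [mul_le_mul_of_nonneg_right h hX, mul_le_mul_of_nonneg_left hXY hs2, mul_le_mul_of_nonneg_right h2 hO]
    · nlinarith [mul_le_mul_of_nonneg_right h hY, mul_le_mul_of_nonneg_left hXY hs1, mul_le_mul_of_nonneg_right h1 hO]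
  nlinarith [mul_le_mul_of_nonneg_right hN hG0, mul_le_mul_of_nonneg_left (hG.trans hkey) hs0,
    mul_le_mul_of_nonneg_right hNO hM]

/-- A sum over the subsets of a pair `{a, b}` (`a ≠ b`) has the four terms `∅, {a}, {b}, {a, b}`. [folklore] -/
theorem sum_powerset_pair {α : Type*} [DecidableEq α] {a b : α} (h : a ≠ b) (f : Finset α → ℝ) :
    ∑ t ∈ ({a, b} : Finset α).powerset, f t = f ∅ + f {a} + f {b} + f {a, b} := by
  rw [Finset.sum_powerset_insert (by rwa [Finset.mem_singleton]), show ({b} : Finset α) = insert b ∅ from rfl,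
    show ({a} : Finset α) = insert a ∅ from rfl, Finset.sum_powerset_insert (Finset.notMem_empty b),
    Finset.sum_powerset_insert (Finset.notMem_empty b), Finset.powerset_empty, Finset.sum_singleton,
    Finset.sum_singleton, Finset.sum_singleton, Finset.sum_singleton]
  ring

section Reach

variable {V : Type*} {c : V} {B : Set V} {ω : BondConfig V}

/-- Under `σ_B` the pair to `u ∈ B`, `u ≠ c`, is open, so `c ↔ u`. [cite: KozmaNitzan2024, Lemma 5 (p. 13)] -/
theorem reach_of_mem_star (hσ : ω ∈ starEvent c B) {u : V} (huB : u ∈ B) (huc : u ≠ c) :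
    (openGraph ω).Reachable c u :=
  ((openGraph_adj ω c u).2 ⟨((mem_starEvent_iff c B ω).1 hσ u huc).2 huB, huc.symm⟩).reachable

/-- An open path of `G ∖ {c}` is an open path of `G`. [folklore] -/
theorem reach_of_offReach {x y : ({c}ᶜ : Set V)}
    (h : (openGraph (restrictConfig (Subtype.val : ({c}ᶜ : Set V) → V) ω)).Reachable x y) :
    (openGraph ω).Reachable x y :=
  reachable_of_openConnIn ((reachable_restrictConfig_val_iff _ ω x y).1 h)

/-- Under `σ_B` with `B ⊆ {u}`, an open path between vertices `≠ c` re-routes off `c` (cut it at its visits to `c`: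
it enters and leaves through `u`). [cite: KozmaNitzan2024, Lemma 5 (p. 13)] -/
theorem offReach_of_star_subset_singleton (hσ : ω ∈ starEvent c B) {u : V} (hB : B ⊆ {u})
    (x y : ({c}ᶜ : Set V)) (h : (openGraph ω).Reachable x y) :
    (openGraph (restrictConfig (Subtype.val : ({c}ᶜ : Set V) → V) ω)).Reachable x y := by
  rw [reachable_restrictConfig_val_iff]
  obtain ⟨p⟩ := h
  rcases (walk_decomp hσ p (mem_compl_singleton_iff.1 y.2)).1 (mem_compl_singleton_iff.1 x.2) with
    h | ⟨⟨u₁, hu₁, -, hxu⟩, ⟨u₂, hu₂, -, huy⟩⟩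
  · exact h
  · rw [Set.mem_singleton_iff.1 (hB hu₁)] at hxu
    rw [Set.mem_singleton_iff.1 (hB hu₂)] at huy
    exact openConnIn_trans hxu huy

variable [Fintype V] (w : Sym2 V → unitInterval) (o b a₁ a₂ : V)

/-- **ML6-Harris for every finite vertex type** (the `Fin n` case is `stub_obsLemma4MultHarris_c8`): if `a₁ ≠ a₂` and
`μ(a₁ ↔ b) ≤ μ(a₂ ↔ b)` then `μ(gain_o) ≤ μ({o ↔ a₁} ∪ {o ↔ a₂}) · μ({a₁ ↮ b} ∩ {a₂ ↔ b})` (observer Lemma 4, Harris, division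
by `μ(a₁ ↮ a₂)`). [cite: KozmaNitzan2024, Lemma 4 (p. 9)] [cite: VandenbergHaggstromKahn2005, Thm. 1.4 (p. 7)] -/
theorem harrisML6 (h12 : a₁ ≠ a₂) (hτ : (prodBernoulli w).real (openConn a₁ b) ≤ (prodBernoulli w).real (openConn a₂ b)) :
    (prodBernoulli w).real
        ((openConn o b)ᶜ ∩ (openConn o a₁ ∪ openConn o a₂) ∩ (openConn a₁ b ∪ openConn a₂ b) : Set (BondConfig V)) ≤
      (prodBernoulli w).real (openConn o a₁ ∪ openConn o a₂ : Set (BondConfig V)) *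
        (prodBernoulli w).real ((openConn a₁ b)ᶜ ∩ openConn a₂ b : Set (BondConfig V)) := by
  have hm : ∀ s : Set (BondConfig V), MeasurableSet s := fun _ => MeasurableSet.of_discrete
  have key := ObsLemma4Mult.obsLemma4Mult w o b a₁ a₂ h12 hτ
  rw [inter_comm ((openConn a₁ a₂)ᶜ)] at key
  have hH := prodBernoulli_harris_upper_lower w ((isUpperSet_openConn o a₁).union (isUpperSet_openConn o a₂))
    (isUpperSet_openConn a₁ a₂).compl (hm _) (hm _)
  by_cases hD0 : (prodBernoulli w).real ((openConn a₁ a₂)ᶜ : Set (BondConfig V)) = 0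
  · rw [measureReal_mono_null (ObsLemma4Mult.gain_subset_compl o b a₁ a₂) hD0]
    exact mul_nonneg measureReal_nonneg measureReal_nonneg
  · refine le_of_mul_le_mul_left (key.trans ?_) (lt_of_le_of_ne measureReal_nonneg (Ne.symm hD0))
    nlinarith [mul_le_mul_of_nonneg_right hH
      (measureReal_nonneg : 0 ≤ (prodBernoulli w).real ((openConn a₁ b)ᶜ ∩ openConn a₂ b : Set (BondConfig V)))]

/-- Harris: `μ(o ↮ a₁, o ↔ a₂) + μ(o ↮ a₂, o ↔ a₁) ≤ μ(o ↔ A)·μ(a₁ ↮ a₂)` (the two events are disjoint and lie in the increasing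
`{o ↔ A}` met with the decreasing `{a₁ ↮ a₂}`; used on `G ∖ {c}` in the case `b = c`). [cite: VandenbergHaggstromKahn2005, Thm. 1.4 (p. 7)] -/
theorem real_XY_le : (prodBernoulli w).real ((openConn o a₁)ᶜ ∩ openConn o a₂ : Set (BondConfig V)) +
      (prodBernoulli w).real ((openConn o a₂)ᶜ ∩ openConn o a₁ : Set (BondConfig V)) ≤
    (prodBernoulli w).real (openConn o a₁ ∪ openConn o a₂ : Set (BondConfig V)) *
      (prodBernoulli w).real ((openConn a₁ a₂)ᶜ : Set (BondConfig V)) := by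
  have hm : ∀ s : Set (BondConfig V), MeasurableSet s := fun _ => MeasurableSet.of_discrete
  rw [← measureReal_union (Set.disjoint_left.2 fun ω h h' => h.1 h'.2) (hm _)]
  refine (measureReal_mono ?_).trans (prodBernoulli_harris_upper_lower _
    ((isUpperSet_openConn _ _).union (isUpperSet_openConn _ _)) (isUpperSet_openConn _ _).compl (hm _) (hm _))
  rintro ω (⟨hn1, h2⟩ | ⟨hn2, h1⟩)
  · exact ⟨Or.inr h2, fun h => hn1 (SimpleGraph.Reachable.trans h2 (SimpleGraph.Reachable.symm h))⟩
  · exact ⟨Or.inl h1, fun h => hn2 (SimpleGraph.Reachable.trans h1 h)⟩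

end Reach

/-! ### The star decomposition at the spectator (vertex type `Fin n`; primed points live in `G ∖ {c}`) -/

section Stars

variable {n : ℕ} (w : Sym2 (Fin n) → unitInterval) {c : Fin n} (o' b' a₁' a₂' : ({c}ᶜ : Set (Fin n)))

/-- The star of `c` is independent of the configuration off `c` (law `μ'`). [cite: KozmaNitzan2024, proof of Thm. 4 (p. 14)] -/
theorem real_star_inter (B : Set (Fin n)) (E : Set (BondConfig ({c}ᶜ : Set (Fin n)))) :
    (prodBernoulli w).real (starEvent c B ∩ restrictConfig Subtype.val ⁻¹' E) =
      (prodBernoulli w).real (starEvent c B) * (prodBernoulli (w ∘ Sym2.map Subtype.val)).real E := by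
  rw [real_starEvent_inter_preimage, real_preimage_restrictConfig_val]

/-- `μ(σ_∅)·μ'(o ↔ A) ≤ μ(N ∩ O_A)`: under `σ_∅` the spectator is isolated. [cite: KozmaNitzan2024, proof of Thm. 4 (p. 14)] -/
theorem real_N_inter_ge : (prodBernoulli w).real (starEvent c ∅) *
      (prodBernoulli (w ∘ Sym2.map Subtype.val)).real (openConn o' a₁' ∪ openConn o' a₂') ≤ (prodBernoulli w).real
    ((openConn c a₁')ᶜ ∩ (openConn c a₂')ᶜ ∩ (openConn (o' : Fin n) a₁' ∪ openConn (o' : Fin n) a₂')) := by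
  refine (real_star_inter w _ _).symm.trans_le (measureReal_mono ?_)
  rintro ω ⟨hσ, hO⟩
  exact ⟨⟨not_reachable_of_mem_starEvent_empty hσ (mem_compl_singleton_iff.1 a₁'.2),
    not_reachable_of_mem_starEvent_empty hσ (mem_compl_singleton_iff.1 a₂'.2)⟩, hO.imp reach_of_offReach reach_of_offReach⟩

/-- `μ(B ∖ A) = μ(A ∪ B) − μ(A)`. [folklore] -/
theorem real_diff_eq (A B : Set (BondConfig (Fin n))) :
    (prodBernoulli w).real (B \ A) = (prodBernoulli w).real (A ∪ B) - (prodBernoulli w).real A := by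
  rw [← union_sdiff_self, measureReal_union disjoint_sdiff_right MeasurableSet.of_discrete]; ring

/-- Case `b = c`, the pair's own gain under one star: `μ(σ_{v})·μ'(u ↮ v) ≤ μ({v ↔ c} ∖ {u ↔ c})` (under `σ_{v}`, `v ↔ c`,
and an open path from `c` to `u` leaves `c` through `v`). [cite: KozmaNitzan2024, Lemma 5 (p. 13)] -/
theorem real_star_mul_le_diff (u v : ({c}ᶜ : Set (Fin n))) :
    (prodBernoulli w).real (starEvent c {(v : Fin n)}) * (prodBernoulli (w ∘ Sym2.map Subtype.val)).real (openConn u v)ᶜ ≤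
      (prodBernoulli w).real (openConn (v : Fin n) c \ openConn (u : Fin n) c) := by
  refine (real_star_inter w _ _).symm.trans_le (measureReal_mono ?_)
  rintro ω ⟨hσ, hD⟩
  refine ⟨(reach_of_mem_star hσ (Set.mem_singleton _) (mem_compl_singleton_iff.1 v.2)).symm, fun huc => hD ?_⟩
  obtain ⟨p⟩ := SimpleGraph.Reachable.symm huc
  obtain ⟨u', hu', -, h⟩ := (walk_decomp hσ p (mem_compl_singleton_iff.1 u.2)).2 rfl
  exact ((reachable_restrictConfig_val_iff _ ω v u).2 (Set.mem_singleton_iff.1 hu' ▸ h)).symm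

/-- Case `b = c`, star `σ_{u}`: `o ↮ c` forces `o ↮ u` off `c`, and `o ↔ v` re-routes off `c`. [cite: KozmaNitzan2024, Lemma 5 (p. 13)] -/
theorem gain_center_star_subset (u v : ({c}ᶜ : Set (Fin n))) :
    (openConn (o' : Fin n) c)ᶜ ∩ (openConn (o' : Fin n) u ∪ openConn (o' : Fin n) v) ∩
        (openConn (u : Fin n) c ∪ openConn (v : Fin n) c) ∩ starEvent c {(u : Fin n)} ⊆
      starEvent c {(u : Fin n)} ∩ restrictConfig Subtype.val ⁻¹' ((openConn o' u)ᶜ ∩ openConn o' v) := by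
  rintro ω ⟨⟨⟨hoc, hoA⟩, -⟩, hσ⟩
  have hcu := reach_of_mem_star hσ (Set.mem_singleton _) (mem_compl_singleton_iff.1 u.2)
  refine ⟨hσ, fun h' => hoc ((reach_of_offReach h').trans hcu.symm), ?_⟩
  rcases hoA with h | h
  · exact absurd (SimpleGraph.Reachable.trans h hcu.symm) hoc
  · exact offReach_of_star_subset_singleton hσ Subset.rfl o' v h

/-- If the spectator is a relay then `N = {c ↮ a₁} ∩ {c ↮ a₂}` is empty. [folklore] -/
theorem real_N_eq_zero {x y : Fin n} (h : x = c ∨ y = c) :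
    (prodBernoulli w).real ((openConn c x)ᶜ ∩ (openConn c y)ᶜ : Set (BondConfig (Fin n))) = 0 := by
  rw [← measureReal_empty (μ := prodBernoulli w),
    (Set.eq_empty_iff_forall_notMem.2 _ : ((openConn c x)ᶜ ∩ (openConn c y)ᶜ : Set (BondConfig (Fin n))) = ∅)]
  rintro ω ⟨hx, hy⟩
  rcases h with rfl | rfl
  exacts [hx (SimpleGraph.Reachable.refl _), hy (SimpleGraph.Reachable.refl _)]

/-- The right-hand side of ML5 is nonnegative (`min_j μ(a_j↔b) ≤ μ(a₁↔b ∪ a₂↔b)`). [folklore] -/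
theorem rhs_nonneg (X A B Y Z : Set (BondConfig (Fin n))) : 0 ≤ (prodBernoulli w).real X *
      ((prodBernoulli w).real (A ∪ B) - min ((prodBernoulli w).real A) ((prodBernoulli w).real B)) +
    (prodBernoulli w).real Y * (prodBernoulli w).real Z :=
  add_nonneg (mul_nonneg measureReal_nonneg (sub_nonneg.2 ((min_le_left _ _).trans (measureReal_mono subset_union_left))))
    (mul_nonneg measureReal_nonneg measureReal_nonneg)

variable (hw : ∀ z : Fin n, z ≠ a₁' → z ≠ a₂' → z ≠ c → w s(c, z) = 0) (h12 : a₁' ≠ a₂')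
include hw h12

/-- **The four stars of the spectator partition the space**: if every pair `s(c, z)`, `z ∉ {a₁, a₂, c}`, has weight `0`
then `μ(E) = μ(E ∩ σ_∅) + μ(E ∩ σ_{a₁}) + μ(E ∩ σ_{a₂}) + μ(E ∩ σ_{a₁,a₂})`. [cite: KozmaNitzan2024, proof of Thm. 4 (pp. 13–14)] -/
theorem real_eq_four (E : Set (BondConfig (Fin n))) :
    (prodBernoulli w).real E = (prodBernoulli w).real (E ∩ starEvent c ∅) + (prodBernoulli w).real (E ∩ starEvent c {↑a₁'}) +
      (prodBernoulli w).real (E ∩ starEvent c {↑a₂'}) + (prodBernoulli w).real (E ∩ starEvent c {↑a₁', ↑a₂'}) := by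
  have hcA : c ∉ ({(a₁' : Fin n), (a₂' : Fin n)} : Finset (Fin n)) := by
    simpa only [Finset.mem_insert, Finset.mem_singleton, not_or] using
      ⟨fun h => mem_compl_singleton_iff.1 a₁'.2 h.symm, fun h => mem_compl_singleton_iff.1 a₂'.2 h.symm⟩
  have hiso : ∀ u, u ≠ c → u ∉ ({(a₁' : Fin n), (a₂' : Fin n)} : Finset (Fin n)) → w s(c, u) = 0 := fun u huc huA => by
    simp only [Finset.mem_insert, Finset.mem_singleton, not_or] at huA
    exact hw u huA.1 huA.2 huc
  rw [real_eq_sum_inter_starEvent w _ c hcA hiso E, sum_powerset_pair (fun h => h12 (Subtype.ext h))]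
  simp only [Finset.coe_empty, Finset.coe_singleton, Finset.coe_pair]

/-- `μ(N) ≤ μ(σ_∅)`: under a nonempty star the spectator is joined to a relay. [cite: KozmaNitzan2024, proof of Thm. 4 (p. 14)] -/
theorem real_N_le : (prodBernoulli w).real ((openConn c a₁')ᶜ ∩ (openConn c a₂')ᶜ : Set (BondConfig (Fin n))) ≤
    (prodBernoulli w).real (starEvent c ∅) := by
  have e : ∀ B : Set (Fin n), ((a₁' : Fin n) ∈ B ∨ (a₂' : Fin n) ∈ B) →
      ((openConn c a₁')ᶜ ∩ (openConn c a₂')ᶜ : Set (BondConfig (Fin n))) ∩ starEvent c B = ∅ := by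
    refine fun B hB => Set.eq_empty_iff_forall_notMem.2 ?_
    rintro ω ⟨⟨h1, h2⟩, hσ⟩
    rcases hB with h | h
    exacts [h1 (reach_of_mem_star hσ h (mem_compl_singleton_iff.1 a₁'.2)),
      h2 (reach_of_mem_star hσ h (mem_compl_singleton_iff.1 a₂'.2))]
  rw [real_eq_four w a₁' a₂' hw h12, e _ (Or.inl (Set.mem_singleton _)), e _ (Or.inr (Set.mem_singleton _)),
    e _ (Or.inl (Set.mem_insert _ _)), measureReal_empty, add_zero, add_zero, add_zero]
  exact measureReal_mono inter_subset_right

/-- `μ(gain_o) ≤ (μ σ_∅ + μ σ_{a₁} + μ σ_{a₂})·μ'(gain_o)`: under a star with at most one relay the observer's gain event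
forces the same event off `c`, and under the full star the relays are glued through `c` (no gain).
[cite: KozmaNitzan2024, Lemma 5 and proof of Thm. 4 (pp. 13–14)] -/
theorem real_gain_le : (prodBernoulli w).real ((openConn (o' : Fin n) b')ᶜ ∩ (openConn (o' : Fin n) a₁' ∪ openConn (o' : Fin n) a₂') ∩
      (openConn (a₁' : Fin n) b' ∪ openConn (a₂' : Fin n) b')) ≤
    ((prodBernoulli w).real (starEvent c ∅) + (prodBernoulli w).real (starEvent c {↑a₁'}) +
        (prodBernoulli w).real (starEvent c {↑a₂'})) * (prodBernoulli (w ∘ Sym2.map Subtype.val)).real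
      ((openConn o' b')ᶜ ∩ (openConn o' a₁' ∪ openConn o' a₂') ∩ (openConn a₁' b' ∪ openConn a₂' b')) := by
  have hsub : ∀ (B : Set (Fin n)) (u : Fin n), B ⊆ {u} →
      (openConn (o' : Fin n) b')ᶜ ∩ (openConn (o' : Fin n) a₁' ∪ openConn (o' : Fin n) a₂') ∩
          (openConn (a₁' : Fin n) b' ∪ openConn (a₂' : Fin n) b') ∩ starEvent c B ⊆ starEvent c B ∩
        restrictConfig Subtype.val ⁻¹' ((openConn o' b')ᶜ ∩ (openConn o' a₁' ∪ openConn o' a₂') ∩ (openConn a₁' b' ∪ openConn a₂' b')) := by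
    rintro B u hB ω ⟨⟨⟨hob, hoA⟩, hAb⟩, hσ⟩
    exact ⟨hσ, ⟨fun h => hob (reach_of_offReach h), hoA.imp (offReach_of_star_subset_singleton hσ hB o' a₁')
      (offReach_of_star_subset_singleton hσ hB o' a₂')⟩, hAb.imp (offReach_of_star_subset_singleton hσ hB a₁' b')
      (offReach_of_star_subset_singleton hσ hB a₂' b')⟩
  have h12e : (openConn (o' : Fin n) b')ᶜ ∩ (openConn (o' : Fin n) a₁' ∪ openConn (o' : Fin n) a₂') ∩
      (openConn (a₁' : Fin n) b' ∪ openConn (a₂' : Fin n) b') ∩ starEvent c {↑a₁', ↑a₂'} = ∅ := by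
    rw [Set.eq_empty_iff_forall_notMem]
    rintro ω ⟨⟨⟨hob, hoA⟩, hAb⟩, hσ⟩
    have hc1 := reach_of_mem_star hσ (Set.mem_insert _ _) (mem_compl_singleton_iff.1 a₁'.2)
    have hc2 := reach_of_mem_star hσ (Set.mem_insert_of_mem _ (Set.mem_singleton _)) (mem_compl_singleton_iff.1 a₂'.2)
    have hoc : (openGraph ω).Reachable o' c :=
      hoA.elim (fun h => SimpleGraph.Reachable.trans h hc1.symm) fun h => SimpleGraph.Reachable.trans h hc2.symm
    exact hob (hAb.elim (fun h => (hoc.trans hc1).trans h) fun h => (hoc.trans hc2).trans h)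
  conv_lhs => rw [real_eq_four w a₁' a₂' hw h12]
  rw [h12e, measureReal_empty, add_zero]
  have t0 := (measureReal_mono (μ := prodBernoulli w) (hsub ∅ a₁' (empty_subset _))).trans_eq (real_star_inter w _ _)
  have t1 := (measureReal_mono (μ := prodBernoulli w) (hsub _ a₁' Subset.rfl)).trans_eq (real_star_inter w _ _)
  have t2 := (measureReal_mono (μ := prodBernoulli w) (hsub _ a₂' Subset.rfl)).trans_eq (real_star_inter w _ _)
  linarith

/-- `(μ σ_∅ + μ σ_{a₁} + μ σ_{a₂})·μ'(a₁ ↮ b, a₂ ↔ b) ≤ μ(a₁↔b ∪ a₂↔b) − μ(a₁↔b)`: under a star with at most one relay an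
open path between non-spectator vertices re-routes off `c`. [cite: KozmaNitzan2024, Lemma 5 and proof of Thm. 4 (pp. 13–14)] -/
theorem real_diff_ge : ((prodBernoulli w).real (starEvent c ∅) + (prodBernoulli w).real (starEvent c {↑a₁'}) +
        (prodBernoulli w).real (starEvent c {↑a₂'})) *
      (prodBernoulli (w ∘ Sym2.map Subtype.val)).real ((openConn a₁' b')ᶜ ∩ openConn a₂' b') ≤
    (prodBernoulli w).real (openConn (a₁' : Fin n) b' ∪ openConn (a₂' : Fin n) b') -
      (prodBernoulli w).real (openConn (a₁' : Fin n) b') := by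
  have hsub : ∀ (B : Set (Fin n)) (u : Fin n), B ⊆ {u} →
      starEvent c B ∩ restrictConfig Subtype.val ⁻¹' ((openConn a₁' b')ᶜ ∩ openConn a₂' b') ⊆
        (openConn (a₂' : Fin n) b' \ openConn (a₁' : Fin n) b') ∩ starEvent c B := by
    rintro B u hB ω ⟨hσ, hn1, h2⟩
    exact ⟨⟨reach_of_offReach h2, fun h1 => hn1 (offReach_of_star_subset_singleton hσ hB a₁' b' h1)⟩, hσ⟩
  rw [← real_diff_eq w]
  conv_rhs => rw [real_eq_four w a₁' a₂' hw h12]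
  have t0 := (real_star_inter w ∅ _).symm.trans_le (measureReal_mono (μ := prodBernoulli w) (hsub ∅ a₁' (empty_subset _)))
  have t1 := (real_star_inter w _ _).symm.trans_le (measureReal_mono (μ := prodBernoulli w) (hsub _ a₁' Subset.rfl))
  have t2 := (real_star_inter w _ _).symm.trans_le (measureReal_mono (μ := prodBernoulli w) (hsub _ a₂' Subset.rfl))
  have t12 : 0 ≤ (prodBernoulli w).real
      ((openConn (a₂' : Fin n) b' \ openConn (a₁' : Fin n) b') ∩ starEvent c {↑a₁', ↑a₂'}) := measureReal_nonneg
  linarith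

/-- **The main case, oriented** (`o, b, a₁, a₂ ≠ c`, `a₁ ≠ a₂`, `a₁` the weaker relay of `G ∖ {c}`):
`μ(N)·μ(gain_o) ≤ μ(N ∩ O_A)·G_max + μ(N ∩ O_Aᶜ)·μ(gain_c)` by the star bounds above and ML6-Harris on `G ∖ {c}` (the last
summand is only used through its sign). [cite: KozmaNitzan2024, Lemma 4 (p. 9) and proof of Thm. 4 (pp. 13–14)] -/
theorem oriented (hτ : (prodBernoulli (w ∘ Sym2.map Subtype.val)).real (openConn a₁' b') ≤
      (prodBernoulli (w ∘ Sym2.map Subtype.val)).real (openConn a₂' b')) :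
    (prodBernoulli w).real ((openConn c a₁')ᶜ ∩ (openConn c a₂')ᶜ : Set (BondConfig (Fin n))) *
      (prodBernoulli w).real ((openConn (o' : Fin n) b')ᶜ ∩ (openConn (o' : Fin n) a₁' ∪ openConn (o' : Fin n) a₂') ∩
        (openConn (a₁' : Fin n) b' ∪ openConn (a₂' : Fin n) b')) ≤
    (prodBernoulli w).real ((openConn c a₁')ᶜ ∩ (openConn c a₂')ᶜ ∩ (openConn (o' : Fin n) a₁' ∪ openConn (o' : Fin n) a₂')) *
        ((prodBernoulli w).real (openConn (a₁' : Fin n) b' ∪ openConn (a₂' : Fin n) b') -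
          min ((prodBernoulli w).real (openConn (a₁' : Fin n) b')) ((prodBernoulli w).real (openConn (a₂' : Fin n) b'))) +
      (prodBernoulli w).real ((openConn c a₁')ᶜ ∩ (openConn c a₂')ᶜ ∩ (openConn (o' : Fin n) a₁' ∪ openConn (o' : Fin n) a₂')ᶜ) *
        (prodBernoulli w).real ((openConn c b')ᶜ ∩ (openConn c a₁' ∪ openConn c a₂') ∩
          (openConn (a₁' : Fin n) b' ∪ openConn (a₂' : Fin n) b')) := by
  haveI : Fintype ({c}ᶜ : Set (Fin n)) := Fintype.ofFinite _
  exact arith_chain (real_N_le w a₁' a₂' hw h12) (real_gain_le w o' b' a₁' a₂' hw h12) (harrisML6 _ o' b' a₁' a₂' h12 hτ)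
    (real_diff_ge w b' a₁' a₂' hw h12) (real_N_inter_ge w o' a₁' a₂') (min_le_left _ _) measureReal_nonneg measureReal_nonneg
    (add_nonneg (add_nonneg measureReal_nonneg measureReal_nonneg) measureReal_nonneg) measureReal_nonneg measureReal_nonneg
    (mul_nonneg measureReal_nonneg measureReal_nonneg)

/-- **The case `b = c`** (target = spectator; `o, a₁, a₂ ≠ c`, `a₁ ≠ a₂`): under `σ_∅` no relay reaches `c`, under `σ_{a₁,a₂}`
an observer reaching a relay reaches `c`, so `μ(gain_o) ≤ μ(σ_{a₁})·μ'(o ↮ a₁, o ↔ a₂) + μ(σ_{a₂})·μ'(o ↮ a₂, o ↔ a₁)`, which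
Harris on `G ∖ {c}` and the one-star relay gains control. [cite: KozmaNitzan2024, Lemma 5 and proof of Thm. 4 (pp. 13–14)] -/
theorem center : (prodBernoulli w).real ((openConn c a₁')ᶜ ∩ (openConn c a₂')ᶜ : Set (BondConfig (Fin n))) *
      (prodBernoulli w).real ((openConn (o' : Fin n) c)ᶜ ∩ (openConn (o' : Fin n) a₁' ∪ openConn (o' : Fin n) a₂') ∩
        (openConn (a₁' : Fin n) c ∪ openConn (a₂' : Fin n) c)) ≤
    (prodBernoulli w).real ((openConn c a₁')ᶜ ∩ (openConn c a₂')ᶜ ∩ (openConn (o' : Fin n) a₁' ∪ openConn (o' : Fin n) a₂')) *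
        ((prodBernoulli w).real (openConn (a₁' : Fin n) c ∪ openConn (a₂' : Fin n) c) -
          min ((prodBernoulli w).real (openConn (a₁' : Fin n) c)) ((prodBernoulli w).real (openConn (a₂' : Fin n) c))) +
      (prodBernoulli w).real ((openConn c a₁')ᶜ ∩ (openConn c a₂')ᶜ ∩ (openConn (o' : Fin n) a₁' ∪ openConn (o' : Fin n) a₂')ᶜ) *
        (prodBernoulli w).real ((openConn c c)ᶜ ∩ (openConn c a₁' ∪ openConn c a₂') ∩
          (openConn (a₁' : Fin n) c ∪ openConn (a₂' : Fin n) c)) := by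
  haveI : Fintype ({c}ᶜ : Set (Fin n)) := Fintype.ofFinite _
  have h1c := mem_compl_singleton_iff.1 a₁'.2
  have h2c := mem_compl_singleton_iff.1 a₂'.2
  have hD : ((openConn a₂' a₁')ᶜ : Set (BondConfig ({c}ᶜ : Set (Fin n)))) = (openConn a₁' a₂')ᶜ := by
    rw [KNPreFKG.openConn_symm]
  have h2 := real_star_mul_le_diff w a₁' a₂'
  have h1 := real_star_mul_le_diff w a₂' a₁'
  rw [real_diff_eq] at h1 h2
  rw [hD, union_comm] at h1
  have e2 := gain_center_star_subset o' a₂' a₁'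
  rw [union_comm (openConn (o' : Fin n) a₂'), union_comm (openConn (a₂' : Fin n) c)] at e2
  refine arith_center (real_N_le w a₁' a₂' hw h12) ?_ (real_XY_le _ o' a₁' a₂') (h1.trans (sub_le_sub_left (min_le_right _ _) _))
    (h2.trans (sub_le_sub_left (min_le_left _ _) _)) (real_N_inter_ge w o' a₁' a₂') measureReal_nonneg measureReal_nonneg
    measureReal_nonneg measureReal_nonneg measureReal_nonneg measureReal_nonneg measureReal_nonneg measureReal_nonneg
    (mul_nonneg measureReal_nonneg measureReal_nonneg)
  -- `μ(gain_o) ≤ μ(σ_{a₁})·μ'(o ↮ a₁, o ↔ a₂) + μ(σ_{a₂})·μ'(o ↮ a₂, o ↔ a₁)`, star by star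
  conv_lhs => rw [real_eq_four w a₁' a₂' hw h12]
  refine (add_le_add (add_le_add (add_le_add (?_ : _ ≤ (0 : ℝ))
    ((measureReal_mono (μ := prodBernoulli w) (gain_center_star_subset o' a₁' a₂')).trans_eq (real_star_inter w _ _)))
    ((measureReal_mono (μ := prodBernoulli w) e2).trans_eq (real_star_inter w _ _))) (?_ : _ ≤ (0 : ℝ))).trans_eq (by ring)
  · refine (measureReal_mono (μ := prodBernoulli w) ?_).trans_eq measureReal_empty
    rintro ω ⟨⟨-, h | h⟩, hσ⟩
    exacts [not_reachable_of_mem_starEvent_empty hσ h1c (SimpleGraph.Reachable.symm h),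
      not_reachable_of_mem_starEvent_empty hσ h2c (SimpleGraph.Reachable.symm h)]
  · refine (measureReal_mono (μ := prodBernoulli w) ?_).trans_eq measureReal_empty
    rintro ω ⟨⟨⟨hoc, h | h⟩, -⟩, hσ⟩
    exacts [hoc (SimpleGraph.Reachable.trans h (reach_of_mem_star hσ (Set.mem_insert _ _) h1c).symm),
      hoc (SimpleGraph.Reachable.trans h (reach_of_mem_star hσ (Set.mem_insert_of_mem _ (Set.mem_singleton _)) h2c).symm)]

end Stars

end ML5Base

open ML5Base in
/-- **Registered stub `stub_ml5Base_c9`** (line `tieline`, crux `AdditiveGluing`): the BASE CASE of the mixture inequality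
ML5 — every positive-weight pair at the spectator `c` goes to a relay `a₁` or `a₂`.  With `N = {c ↮ a₁} ∩ {c ↮ a₂}`,
`O_A = {o ↔ a₁} ∪ {o ↔ a₂}`, `gain_x = {x ↮ b} ∩ ({x ↔ a₁} ∪ {x ↔ a₂}) ∩ ({a₁ ↔ b} ∪ {a₂ ↔ b})`,
`G_max = μ(a₁↔b ∪ a₂↔b) − min_j μ(a_j↔b)`:  `μ(N)·μ(gain_o) ≤ μ(N ∩ O_A)·G_max + μ(N ∩ O_Aᶜ)·μ(gain_c)`.
Star decomposition at `c`, Lemma 5's path surgery and ML6-Harris on `G ∖ {c}` (`ML5Base.oriented`, `ML5Base.center`).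
[cite: KozmaNitzan2024, Lemma 4 (p. 9), Lemma 5 and Thm. 4 (pp. 13–14)] [cite: VandenbergHaggstromKahn2005, Thm. 1.4 (p. 7)] -/
theorem stub_ml5Base_c9 : ∀ (n : ℕ) (w : Sym2 (Fin n) → unitInterval) (o b a₁ a₂ c : Fin n), (∀ z : Fin n, z ≠ a₁ → z ≠ a₂ → z ≠ c → w s(c, z) = 0) → (Literature.Probability.LatticeModels.prodBernoulli w).real ((Literature.Probability.Percolation.openConn c a₁)ᶜ ∩ (Literature.Probability.Percolation.openConn c a₂)ᶜ : Set (Literature.Probability.Percolation.BondConfig (Fin n))) * (Literature.Probability.LatticeModels.prodBernoulli w).real ((Literature.Probability.Percolation.openConn o b)ᶜ ∩ (Literature.Probability.Percolation.openConn o a₁ ∪ Literature.Probability.Percolation.openConn o a₂) ∩ (Literature.Probability.Percolation.openConn a₁ b ∪ Literature.Probability.Percolation.openConn a₂ b)) ≤ (Literature.Probability.LatticeModels.prodBernoulli w).real ((Literature.Probability.Percolation.openConn c a₁)ᶜ ∩ (Literature.Probability.Percolation.openConn c a₂)ᶜ ∩ (Literature.Probability.Percolation.openConn o a₁ ∪ Literature.Probability.Percolation.openConn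 o a₂)) * ((Literature.Probability.LatticeModels.prodBernoulli w).real (Literature.Probability.Percolation.openConn a₁ b ∪ Literature.Probability.Percolation.openConn a₂ b) - min ((Literature.Probability.LatticeModels.prodBernoulli w).real (Literature.Probability.Percolation.openConn a₁ b)) ((Literature.Probability.LatticeModels.prodBernoulli w).real (Literature.Probability.Percolation.openConn a₂ b))) + (Literature.Probability.LatticeModels.prodBernoulli w).real ((Literature.Probability.Percolation.openConn c a₁)ᶜ ∩ (Literature.Probability.Percolation.openConn c a₂)ᶜ ∩ (Literature.Probability.Percolation.openConn o a₁ ∪ Literature.Probability.Percolation.openConn o a₂)ᶜ) * (Literature.Probability.LatticeModels.prodBernoulli w).real ((Literature.Probability.Percolation.openConn c b)ᶜ ∩ (Literature.Probability.Percolation.openConn c a₁ ∪ Literature.Probability.Percolation.openConn c a₂) ∩ (Literature.Probability.Percolation.openConn a₁ b ∪ Literature.Probability.Percolation.openConn a₂ b)) := by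
  intro n w o b a₁ a₂ c hw
  -- (D1) `c ∈ {a₁, a₂}`: `N = ∅`
  by_cases hc : a₁ = c ∨ a₂ = c
  · rw [real_N_eq_zero w hc, zero_mul]
    exact rhs_nonneg w _ _ _ _ _
  obtain ⟨h1c, h2c⟩ := not_or.1 hc
  -- (D2) `a₁ = a₂`: `gain_o = ∅`
  by_cases h12 : a₁ = a₂
  · have he : ((openConn o b)ᶜ ∩ (openConn o a₁ ∪ openConn o a₂) ∩ (openConn a₁ b ∪ openConn a₂ b) :
        Set (BondConfig (Fin n))) = ∅ := by
      rw [Set.eq_empty_iff_forall_notMem, ← h12]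
      rintro ω ⟨⟨hob, h | h⟩, h' | h'⟩ <;> exact hob (SimpleGraph.Reachable.trans h h')
    rw [he, measureReal_empty, mul_zero]
    exact rhs_nonneg w _ _ _ _ _
  -- (D3) `o = c`: equality (`N ∩ O_A = ∅`, `N ∩ O_Aᶜ = N`, `gain_o = gain_c`)
  by_cases hoc : o = c
  · rw [hoc]
    have e1 : ((openConn c a₁)ᶜ ∩ (openConn c a₂)ᶜ ∩ (openConn c a₁ ∪ openConn c a₂) : Set (BondConfig (Fin n))) = ∅ := by
      rw [Set.eq_empty_iff_forall_notMem]; rintro ω ⟨⟨h1, h2⟩, h | h⟩; exacts [h1 h, h2 h]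
    have e2 : ((openConn c a₁)ᶜ ∩ (openConn c a₂)ᶜ ∩ (openConn c a₁ ∪ openConn c a₂)ᶜ : Set (BondConfig (Fin n))) =
        (openConn c a₁)ᶜ ∩ (openConn c a₂)ᶜ :=
      inter_eq_left.2 (by rintro ω ⟨h1, h2⟩ (h | h); exacts [h1 h, h2 h])
    rw [e1, e2, measureReal_empty, zero_mul, zero_add]
  obtain ⟨o', rfl⟩ : ∃ o' : ({c}ᶜ : Set (Fin n)), (o' : Fin n) = o := ⟨⟨o, hoc⟩, rfl⟩
  obtain ⟨a₁', rfl⟩ : ∃ a' : ({c}ᶜ : Set (Fin n)), (a' : Fin n) = a₁ := ⟨⟨a₁, h1c⟩, rfl⟩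
  obtain ⟨a₂', rfl⟩ : ∃ a' : ({c}ᶜ : Set (Fin n)), (a' : Fin n) = a₂ := ⟨⟨a₂, h2c⟩, rfl⟩
  have h12' : a₁' ≠ a₂' := fun h => h12 (congrArg Subtype.val h)
  -- (D4) `b = c` (`ML5Base.center`); else the main case (`ML5Base.oriented`), oriented by the weaker relay of `G ∖ {c}`
  by_cases hbc : b = c
  · rw [hbc]
    exact center w o' a₁' a₂' hw h12'
  obtain ⟨b', rfl⟩ : ∃ b' : ({c}ᶜ : Set (Fin n)), (b' : Fin n) = b := ⟨⟨b, hbc⟩, rfl⟩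
  rcases le_total ((prodBernoulli (w ∘ Sym2.map Subtype.val)).real (openConn a₁' b'))
    ((prodBernoulli (w ∘ Sym2.map Subtype.val)).real (openConn a₂' b')) with hτ | hτ
  · exact oriented w o' b' a₁' a₂' hw h12' hτ
  · have key := oriented w o' b' a₂' a₁' (fun z h2 h1 hc => hw z h1 h2 hc) h12'.symm hτ
    rwa [inter_comm (openConn c (a₂' : Fin n))ᶜ, union_comm (openConn (o' : Fin n) a₂'), union_comm (openConn (a₂' : Fin n) b'),
      union_comm (openConn c (a₂' : Fin n)), min_comm] at key

end

end Summit.CriticalPhenomena.PercolationContinuityZ3.Theorems
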